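import Summits.CriticalPhenomena.PercolationContinuityZ3.Theorems.PercNearOneGluingNoHeavyLowerTailSahiT1LexChain
import Summits.CriticalPhenomena.PercolationContinuityZ3.Theorems.PercNearOneGluingNoHeavyLowerTailSahiSharedTwoPointCube
import Literature.Combinatorics.Sahi2008.PushForward
import Mathlib.Tactic.Linarith
import HarnessLib

/-!
# `NoHeavyLowerTail` (crux stmt-CriticalPhenomena-4575), P2 — T₁ WITH `|C| = 1`, THE `z`-DOMINATED HALF ON A SINGLE CUBE:
# Kahn's `C_3` for increasing EVENTS `U₀, U₁, U₂ ⊆ 2^κ` sharing (between `U₀, U₁`) only the coins `z, c`, `U₂` free of `c`, `z` dominating `c`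

Support file (seat `prim-masterthm-p2`, gen 26; `--supports stmt-CriticalPhenomena-4575`; memo `FROM-prim-masterthm-p2-g26-LEX-CHAIN.md` §1).
No `sorry`, no definitions, standard axioms.

**THEOREM (`SahiT1Lex.sahiE_three_nonneg_cube_zdom`).**  Increasing events `U₀, U₁, U₂ ⊆ 2^κ`; coordinates `z ≠ c` with: every coordinate essential
to both `U₀` and `U₁` is `z` or `c`; `c ∉ esupp U₂`; and `z` DOMINATES `c` in `U₀` and in `U₁` — `c ∈ ω, z ∉ ω, ω ∈ U_i ⟹ (ω ∖ {c}) ∪ {z} ∈ U_i`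
(switching `z` on does at least what switching `c` on does).  Then `0 ≤ E_3(μ_p; 1_{U₀},1_{U₁},1_{U₂})` for every product measure with
`0 < p_z, p_c < 1`.  This is the block theorem `SahiT1Lex.sahiE_three_nonneg_T1_zdom` (Theorem C read through the lexicographic order of the
`(z,c)`-square, `…SahiT1LexChain`) transported to one cube: `SahiSharedTwoPointCube.sahiE_three_ind_eq_blocks_free` with the blocks `{z,c}`,
`esupp U₀ ∖ {z,c}`, the rest (gen 14's `glue3`), then the block `2^{z,c}` is identified with `Fin 2 × Fin 2` by a push-forward along the
bijection; the domination hypothesis becomes `f(0,1,·) ≤ f(1,0,·)`, and `c ∉ esupp U₂` makes the third pulled-back function free of the junior letter.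
In the tree's single-cube vocabulary this is the `z`-dominated half of the stratum `T₁(|C| = 1)` of Kahn's Conjecture 5 (memo §0); the other
half (a member with an antichain section `1_{U}(·,·,a) = c`) remains OPEN. [this work]
-/

noncomputable section

open scoped Classical

namespace Summit.CriticalPhenomena.PercolationContinuityZ3.Theorems

namespace SahiT1Lex

open Finset Function
open Literature.Combinatorics.Sahi2008
open Literature.Probability.Percolation (DeterminedBy determinedBy_iff)
open Literature.Probability.Percolation.BHK2006 (weight)
open Literature.Probability.Percolation.DecisionTree (ind ind_of_mem ind_of_not_mem ind_nonneg)
open SahiClassTCube (glue3 glue3_mono mem_glue3_zero mem_glue3_one mem_glue3_two)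

section Cube

variable {κ : Type} [Fintype κ]

omit [Fintype κ] in
/-- `1_U ω ≤ 1_U ω'` as soon as `ω ∈ U → ω' ∈ U`. [folklore] -/
theorem ind_le_ind_of_imp {U : Set (Set κ)} {ω ω' : Set κ} (h : ω ∈ U → ω' ∈ U) : ind U ω ≤ ind U ω' := by
  by_cases hω : ω ∈ U
  · rw [ind_of_mem hω, ind_of_mem (h hω)]
  · rw [ind_of_not_mem hω]; exact ind_nonneg _ _

/-- **KAHN'S `C_3` ON THE `z`-DOMINATED HALF OF `T₁(|C| = 1)`, SINGLE-CUBE FORM.**  Increasing events `U₀, U₁, U₂ ⊆ 2^κ`, two coordinates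
`z ≠ c` such that: every coordinate essential to both `U₀` and `U₁` is `z` or `c`; `c` is not essential to `U₂`; and `z` DOMINATES `c` in `U₀` and in
`U₁` (`c ∈ ω, z ∉ ω, ω ∈ U_i ⟹ (ω ∖ {c}) ∪ {z} ∈ U_i`).  Then for every product measure `μ_p` with `0 < p_z, p_c < 1`:
`0 ≤ E_3(μ_p; 1_{U₀}, 1_{U₁}, 1_{U₂})`.  Proof: `SahiSharedTwoPointCube.sahiE_three_ind_eq_blocks_free` with the blocks `{z,c}`, `esupp U₀ ∖ {z,c}`, the
rest; the block `{z,c}` is identified with `Fin 2 × Fin 2` (push-forward along the bijection), and `sahiE_three_nonneg_T1_zdom` applies. [this work] -/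
theorem sahiE_three_nonneg_cube_zdom {U₀ U₁ U₂ : Set (Set κ)} (hU₀ : IsUpperSet U₀) (hU₁ : IsUpperSet U₁) (hU₂ : IsUpperSet U₂)
    {z c : κ} (hzc : z ≠ c) (hC : ∀ x, x ∈ esupp U₀ → x ∈ esupp U₁ → x = z ∨ x = c) (hc₂ : c ∉ esupp U₂)
    (hdom₀ : ∀ ω : Set κ, c ∈ ω → z ∉ ω → ω ∈ U₀ → insert z (ω \ {c}) ∈ U₀)
    (hdom₁ : ∀ ω : Set κ, c ∈ ω → z ∉ ω → ω ∈ U₁ → insert z (ω \ {c}) ∈ U₁)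
    (p : κ → unitInterval) (hz0 : 0 < (p z : ℝ)) (hz1 : (p z : ℝ) < 1) (hc0 : 0 < (p c : ℝ)) (hc1 : (p c : ℝ) < 1) :
    0 ≤ sahiE (bernoulliWeight p) 3 ![ind U₀, ind U₁, ind U₂] := by
  -- the block labelling: 0 = {z,c}, 1 = the other coordinates of `U₀`, 2 = the rest
  let blk : κ → Fin 3 := fun x => if x = z ∨ x = c then 0 else if x ∈ esupp U₀ then 1 else 2
  have blk_z : blk z = 0 := by simp [blk]
  have blk_c : blk c = 0 := by simp [blk]
  have blk0 : ∀ x, blk x = 0 → x = z ∨ x = c := by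
    intro x hx
    by_contra h
    simp only [blk, h, if_false] at hx
    split_ifs at hx <;> exact absurd hx (by decide)
  have h₀ : DeterminedBy U₀ {x | blk x ≠ 2} := by
    refine (determinedBy_esupp hU₀).mono fun x hx => ?_
    have hx' : x ∈ esupp U₀ := hx
    simp only [Set.mem_setOf_eq, blk, hx', if_true]
    split_ifs <;> decide
  have h₁ : DeterminedBy U₁ {x | blk x ≠ 1} := by
    refine (determinedBy_esupp hU₁).mono fun x hx => ?_
    have hx' : x ∈ esupp U₁ := hx
    simp only [Set.mem_setOf_eq, blk]
    by_cases hzc' : x = z ∨ x = c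
    · simp only [hzc', if_true]; decide
    · have hx0 : x ∉ esupp U₀ := fun h0 => hzc' (hC x h0 hx')
      simp only [hzc', hx0, if_false]; decide
  rw [SahiSharedTwoPointCube.sahiE_three_ind_eq_blocks_free blk U₀ U₁ U₂ p h₀ h₁]
  -- the two points of the block `0`
  let zC : {x // blk x = 0} := ⟨z, blk_z⟩
  let cC : {x // blk x = 0} := ⟨c, blk_c⟩
  have zC_ne_cC : zC ≠ cC := fun h => hzc (congrArg Subtype.val h)
  have pt : ∀ x : {x // blk x = 0}, x = zC ∨ x = cC := fun x =>
    (blk0 x.1 x.2).imp (fun h => Subtype.ext h) (fun h => Subtype.ext h)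
  -- the bijection `Fin 2 × Fin 2 ≃ Set {z,c}`
  let e : Fin 2 × Fin 2 → Set {x // blk x = 0} := fun ij => {x | (x = zC ∧ ij.1 = 1) ∨ (x = cC ∧ ij.2 = 1)}
  have mem_e_z : ∀ ij : Fin 2 × Fin 2, zC ∈ e ij ↔ ij.1 = 1 := fun ij => by
    simp only [e, Set.mem_setOf_eq, true_and]
    exact ⟨fun h => h.elim id fun h' => absurd h'.1 zC_ne_cC, Or.inl⟩
  have mem_e_c : ∀ ij : Fin 2 × Fin 2, cC ∈ e ij ↔ ij.2 = 1 := fun ij => by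
    simp only [e, Set.mem_setOf_eq, true_and]
    exact ⟨fun h => h.elim (fun h' => absurd h'.1.symm zC_ne_cC) id, Or.inr⟩
  let d : Set {x // blk x = 0} → Fin 2 × Fin 2 := fun S => (if zC ∈ S then 1 else 0, if cC ∈ S then 1 else 0)
  have fin2 : ∀ i : Fin 2, i = 0 ∨ i = 1 := fun i => by
    rcases Fin.exists_fin_two.mp ⟨i, rfl⟩ with h | h <;> simp [h]
  have ed : ∀ S, e (d S) = S := by
    intro S; ext x
    rcases pt x with rfl | rfl
    · rw [mem_e_z]; simp only [d]; split_ifs with h <;> simp [h]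
    · rw [mem_e_c]; simp only [d]; split_ifs with h <;> simp [h]
  have de : ∀ ij, d (e ij) = ij := by
    intro ij
    obtain ⟨i, j⟩ := ij
    simp only [d, mem_e_z, mem_e_c]
    rcases fin2 i with rfl | rfl <;> rcases fin2 j with rfl | rfl <;> simp
  have e_inj : Function.Injective e := fun ij ij' h => by rw [← de ij, ← de ij', h]
  have e_bij : Function.Bijective e := ⟨e_inj, fun S => ⟨d S, ed S⟩⟩
  have e_mono : ∀ {i i' j j' : Fin 2}, i ≤ i' → j ≤ j' → e (i, j) ⊆ e (i', j') := by
    intro i i' j j' hii hjj x hx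
    rcases hx with ⟨rfl, h⟩ | ⟨rfl, h⟩
    · refine Or.inl ⟨rfl, le_antisymm (Fin.le_last _) ?_⟩
      have : (1 : Fin 2) ≤ i' := by rw [← h]; exact hii
      exact this
    · refine Or.inr ⟨rfl, le_antisymm (Fin.le_last _) ?_⟩
      have : (1 : Fin 2) ≤ j' := by rw [← h]; exact hjj
      exact this
  -- names for the three blocks and their weights
  set wA : Set {x // blk x = 1} → ℝ := bernoulliWeight (fun a : {x // blk x = 1} => p a.1) with hwA
  set wB : Set {x // blk x = 2} → ℝ := bernoulliWeight (fun b : {x // blk x = 2} => p b.1) with hwB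
  set wC : Set {x // blk x = 0} → ℝ := bernoulliWeight (fun c' : {x // blk x = 0} => p c'.1) with hwC
  -- transport the block `0` along `e`
  let G : Set {x // blk x = 1} × Set {x // blk x = 2} × (Fin 2 × Fin 2) →
      Set {x // blk x = 1} × Set {x // blk x = 2} × Set {x // blk x = 0} := fun q => (q.1, q.2.1, e q.2.2)
  have hG : Function.Injective G := by
    intro q q' hqq
    simp only [G, Prod.mk.injEq] at hqq
    exact Prod.ext hqq.1 (Prod.ext hqq.2.1 (e_inj hqq.2.2))
  have hpush : pushWeight (fun q : Set {x // blk x = 1} × Set {x // blk x = 2} × (Fin 2 × Fin 2) =>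
      wA q.1 * wB q.2.1 * wC (e q.2.2)) G = fun q => wA q.1 * wB q.2.1 * wC q.2.2 := by
    funext q
    have hq : q = G (q.1, q.2.1, d q.2.2) := by simp [G, ed]
    rw [hq, pushWeight_apply_of_injective _ hG]
  rw [← hpush, sahiE_pushWeight]
  -- the pulled-back third function does not see the junior letter (`c ∉ esupp U₂`)
  have third : ∀ (a : Set {x // blk x = 1}) (b : Set {x // blk x = 2}) (i j : Fin 2),
      ind U₂ (glue3 blk (a, b, e (i, j))) = ind U₂ (glue3 blk (a, b, e (i, 0))) := by
    intro a b i j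
    have key : glue3 blk (a, b, e (i, j)) ∈ U₂ ↔ glue3 blk (a, b, e (i, 0)) ∈ U₂ := by
      refine mem_iff_of_inter_esupp_eq hU₂ ?_
      ext x
      simp only [Set.mem_inter_iff, Finset.mem_coe]
      constructor
      · rintro ⟨hx, hxU⟩
        refine ⟨?_, hxU⟩
        have h3 : blk x = 0 ∨ blk x = 1 ∨ blk x = 2 := by
          rcases blk x with ⟨i', hi⟩; interval_cases i' <;> simp
        rcases h3 with h | h | h
        · rw [mem_glue3_zero blk _ h] at hx ⊢
          rcases pt ⟨x, h⟩ with hh | hh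
          · rw [hh] at hx ⊢; rw [mem_e_z] at hx ⊢; exact hx
          · have hxc : x = c := congrArg Subtype.val hh
            exact absurd hxU (by rw [hxc]; exact hc₂)
        · rw [mem_glue3_one blk _ h] at hx ⊢; exact hx
        · rw [mem_glue3_two blk _ h] at hx ⊢; exact hx
      · rintro ⟨hx, hxU⟩
        refine ⟨?_, hxU⟩
        have h3 : blk x = 0 ∨ blk x = 1 ∨ blk x = 2 := by
          rcases blk x with ⟨i', hi⟩; interval_cases i' <;> simp
        rcases h3 with h | h | h
        · rw [mem_glue3_zero blk _ h] at hx ⊢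
          rcases pt ⟨x, h⟩ with hh | hh
          · rw [hh] at hx ⊢; rw [mem_e_z] at hx ⊢; exact hx
          · have hxc : x = c := congrArg Subtype.val hh
            exact absurd hxU (by rw [hxc]; exact hc₂)
        · rw [mem_glue3_one blk _ h] at hx ⊢; exact hx
        · rw [mem_glue3_two blk _ h] at hx ⊢; exact hx
    by_cases hm : glue3 blk (a, b, e (i, j)) ∈ U₂
    · rw [ind_of_mem hm, ind_of_mem (key.1 hm)]
    · rw [ind_of_not_mem hm, ind_of_not_mem fun h' => hm (key.2 h')]
  have hfun : (fun i => (![fun q : Set {x // blk x = 1} × Set {x // blk x = 2} × Set {x // blk x = 0} =>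
        (fun (c' : Set {x // blk x = 0}) (a : Set {x // blk x = 1}) => ind U₀ (glue3 blk (a, ∅, c'))) q.2.2 q.1,
      fun q => (fun (c' : Set {x // blk x = 0}) (b : Set {x // blk x = 2}) => ind U₁ (glue3 blk (∅, b, c'))) q.2.2 q.2.1,
      fun q => (fun (c' : Set {x // blk x = 0}) (a : Set {x // blk x = 1}) (b : Set {x // blk x = 2}) =>
        ind U₂ (glue3 blk (a, b, c'))) q.2.2 q.1 q.2.1] i) ∘ G) =
      ![fun q : Set {x // blk x = 1} × Set {x // blk x = 2} × (Fin 2 × Fin 2) =>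
          (fun (i j : Fin 2) (a : Set {x // blk x = 1}) => ind U₀ (glue3 blk (a, ∅, e (i, j)))) q.2.2.1 q.2.2.2 q.1,
        fun q => (fun (i j : Fin 2) (b : Set {x // blk x = 2}) => ind U₁ (glue3 blk (∅, b, e (i, j)))) q.2.2.1 q.2.2.2 q.2.1,
        fun q => (fun (i : Fin 2) (a : Set {x // blk x = 1}) (b : Set {x // blk x = 2}) => ind U₂ (glue3 blk (a, b, e (i, 0))))
          q.2.2.1 q.1 q.2.1] := by
    funext i q
    fin_cases i
    · rfl
    · rfl
    · show ind U₂ (glue3 blk (q.1, q.2.1, e q.2.2)) = ind U₂ (glue3 blk (q.1, q.2.1, e (q.2.2.1, 0)))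
      exact third q.1 q.2.1 q.2.2.1 q.2.2.2
  rw [hfun]
  -- the domination hypothesis in block form
  have swap_eq : ∀ (a : Set {x // blk x = 1}),
      insert z (glue3 blk (a, ∅, e (0, 1)) \ {c}) = glue3 blk (a, ∅, e (1, 0)) := by
    intro a; ext x
    simp only [Set.mem_insert_iff, Set.mem_sdiff, Set.mem_singleton_iff]
    have h3 : blk x = 0 ∨ blk x = 1 ∨ blk x = 2 := by
      rcases blk x with ⟨i', hi⟩; interval_cases i' <;> simp
    constructor
    · rintro (rfl | ⟨hx, hxc⟩)
      · rw [mem_glue3_zero blk _ blk_z]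
        exact (mem_e_z (1, 0)).2 rfl
      · rcases h3 with h | h | h
        · rcases blk0 x h with rfl | rfl
          · rw [mem_glue3_zero blk _ blk_z]; exact (mem_e_z (1, 0)).2 rfl
          · exact absurd rfl hxc
        · rw [mem_glue3_one blk _ h] at hx ⊢; exact hx
        · rw [mem_glue3_two blk _ h] at hx ⊢; exact hx
    · intro hx
      rcases h3 with h | h | h
      · rcases blk0 x h with rfl | rfl
        · exact Or.inl rfl
        · rw [mem_glue3_zero blk _ blk_c] at hx
          exact absurd ((mem_e_c (1, 0)).1 hx) (by decide)
      · right
        refine ⟨by rw [mem_glue3_one blk _ h] at hx ⊢; exact hx, fun hxc => ?_⟩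
        rw [hxc] at h; rw [blk_c] at h; exact absurd h (by decide)
      · right
        refine ⟨by rw [mem_glue3_two blk _ h] at hx ⊢; exact hx, fun hxc => ?_⟩
        rw [hxc] at h; rw [blk_c] at h; exact absurd h (by decide)
  have swap_eq' : ∀ (b : Set {x // blk x = 2}),
      insert z (glue3 blk (∅, b, e (0, 1)) \ {c}) = glue3 blk (∅, b, e (1, 0)) := by
    intro b; ext x
    simp only [Set.mem_insert_iff, Set.mem_sdiff, Set.mem_singleton_iff]
    have h3 : blk x = 0 ∨ blk x = 1 ∨ blk x = 2 := by
      rcases blk x with ⟨i', hi⟩; interval_cases i' <;> simp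
    constructor
    · rintro (rfl | ⟨hx, hxc⟩)
      · rw [mem_glue3_zero blk _ blk_z]
        exact (mem_e_z (1, 0)).2 rfl
      · rcases h3 with h | h | h
        · rcases blk0 x h with rfl | rfl
          · rw [mem_glue3_zero blk _ blk_z]; exact (mem_e_z (1, 0)).2 rfl
          · exact absurd rfl hxc
        · rw [mem_glue3_one blk _ h] at hx ⊢; exact hx
        · rw [mem_glue3_two blk _ h] at hx ⊢; exact hx
    · intro hx
      rcases h3 with h | h | h
      · rcases blk0 x h with rfl | rfl
        · exact Or.inl rfl
        · rw [mem_glue3_zero blk _ blk_c] at hx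
          exact absurd ((mem_e_c (1, 0)).1 hx) (by decide)
      · right
        refine ⟨by rw [mem_glue3_one blk _ h] at hx ⊢; exact hx, fun hxc => ?_⟩
        rw [hxc] at h; rw [blk_c] at h; exact absurd h (by decide)
      · right
        refine ⟨by rw [mem_glue3_two blk _ h] at hx ⊢; exact hx, fun hxc => ?_⟩
        rw [hxc] at h; rw [blk_c] at h; exact absurd h (by decide)
  have cz01 : ∀ q : Set {x // blk x = 1} × Set {x // blk x = 2} × Set {x // blk x = 0},
      q.2.2 = e (0, 1) → c ∈ glue3 blk q ∧ z ∉ glue3 blk q := by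
    rintro q hq
    refine ⟨(mem_glue3_zero blk q blk_c).2 ?_, fun hz => ?_⟩
    · rw [hq]; exact (mem_e_c (0, 1)).2 rfl
    · rw [mem_glue3_zero blk q blk_z, hq, mem_e_z] at hz
      exact absurd hz (by decide)
  -- positivity and mass of the block-`0` weight
  have wC_pos : ∀ ij, 0 < wC (e ij) := by
    intro ij
    rw [hwC]
    show 0 < weight (fun c' : {x // blk x = 0} => (p c'.1 : ℝ)) (e ij)
    unfold weight
    refine Finset.prod_pos fun x _ => ?_
    rcases pt x with rfl | rfl
    · by_cases hm : zC ∈ e ij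
      · rw [if_pos hm]; exact hz0
      · rw [if_neg hm]; show 0 < 1 - (p z : ℝ); linarith
    · by_cases hm : cC ∈ e ij
      · rw [if_pos hm]; exact hc0
      · rw [if_neg hm]; show 0 < 1 - (p c : ℝ); linarith
  have wC_sum : ∑ ij, wC (e ij) = 1 := by
    rw [e_bij.sum_comp (fun S => wC S), hwC]
    exact sum_bernoulliWeight _
  have key := sahiE_three_nonneg_T1_zdom (α := Set {x // blk x = 1}) (β := Set {x // blk x = 2})
    (wA := wA) (wB := wB) (wC := fun ij => wC (e ij))
    (f := fun i j a => ind U₀ (glue3 blk (a, ∅, e (i, j)))) (g := fun i j b => ind U₁ (glue3 blk (∅, b, e (i, j))))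
    (h := fun i a b => ind U₂ (glue3 blk (a, b, e (i, 0))))
    (by rw [hwA]; exact isFKGMeasure_bernoulliWeight _) (by rw [hwB]; exact isFKGMeasure_bernoulliWeight _) wC_pos wC_sum
    (fun i j a => ind_nonneg _ _)
    (fun i j a a' haa => monotone_ind_of_isUpperSet hU₀ (glue3_mono blk haa le_rfl le_rfl))
    (fun i a j j' hjj => monotone_ind_of_isUpperSet hU₀ (glue3_mono blk le_rfl le_rfl (e_mono le_rfl hjj)))
    (fun a => ind_le_ind_of_imp fun hω => by
      have hcz := cz01 (a, ∅, e (0, 1)) rfl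
      rw [← swap_eq a]; exact hdom₀ _ hcz.1 hcz.2 hω)
    (fun i j b => ind_nonneg _ _)
    (fun i j b b' hbb => monotone_ind_of_isUpperSet hU₁ (glue3_mono blk le_rfl hbb le_rfl))
    (fun i b j j' hjj => monotone_ind_of_isUpperSet hU₁ (glue3_mono blk le_rfl le_rfl (e_mono le_rfl hjj)))
    (fun b => ind_le_ind_of_imp fun hω => by
      have hcz := cz01 (∅, b, e (0, 1)) rfl
      rw [← swap_eq' b]; exact hdom₁ _ hcz.1 hcz.2 hω)
    (fun i a b => ind_nonneg _ _)
    (fun a b i i' hii => monotone_ind_of_isUpperSet hU₂ (glue3_mono blk le_rfl le_rfl (e_mono hii le_rfl)))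
    (fun i b a a' haa => monotone_ind_of_isUpperSet hU₂ (glue3_mono blk haa le_rfl le_rfl))
    (fun i a b b' hbb => monotone_ind_of_isUpperSet hU₂ (glue3_mono blk le_rfl hbb le_rfl))
  exact key

end Cube

end SahiT1Lex

end Summit.CriticalPhenomena.PercolationContinuityZ3.Theorems
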